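import Literature.MathematicalPhysics.QuantumManyBody.GroundStateFeynmanKac
import Mathlib.MeasureTheory.Measure.Lebesgue.EqHaar
import Mathlib.Topology.Connected.PathConnected
import Mathlib.LinearAlgebra.Dimension.Constructions
import HarnessLib

/-!
# Crux `GroundStateRigidity` (stmt-AtomisticToContinuum-9072), line `zoo_reduction`:
# the registered stub `stub_coincidenceFree`

Supports (does not close) stmt-AtomisticToContinuum-9072; stub `stub_coincidenceFree` (CF) of line
`zoo_reduction` (crux skeleton `Sketch` v9). **The coincidence-free box is conull and
label-path-connected (codimension three).** For every `N` and `L`: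

* the coincidence set `{Z ∈ (ℝ³)^N | ∃ i ≠ j, zᵢ = zⱼ}` is Lebesgue-null;
* any two configurations `X, Y` of the open box `Λ_L^N` with pairwise distinct points are joined by
  a continuous path of such configurations inside the box.

## Proof

(a) For `i ≠ j` and a proper submodule `P ⊊ ℝ³`, the set `{Z | zᵢ - zⱼ ∈ P}` is the pull-back of
`P` under the linear map `Z ↦ zᵢ - zⱼ`, a submodule of `(ℝ³)^N`; it is proper (the configuration
`Pi.single i w` with `w ∉ P` is not in it), hence null (`Measure.addHaar_submodule`). With `P = ⊥`
and a finite union over the pairs this gives the null coincidence set.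

(b) Fix `X, Y` coincidence-free in the box. For a pair `i ≠ j` the straight segment
`θ ↦ (1 - θ) X + θ Z` has a coincidence `(1 - θ)(xᵢ - xⱼ) + θ (zᵢ - zⱼ) = 0` only if `θ ≠ 0`
(as `xᵢ ≠ xⱼ`), which forces `zᵢ - zⱼ ∈ ℝ ∙ (xᵢ - xⱼ)`, a proper line of `ℝ³` (rank `≤ 1 < 3`).
So the "bad" intermediate configurations for `X` and for `Y` form a finite union of null sets
(by (a)), while the open box has positive measure (it contains `X`); pick `Z` in the box off the
bad set. The segments `[X, Z]` and `[Y, Z]` stay in the (coordinatewise convex) box and are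
coincidence-free, so `JoinedIn.ofLine` twice and `JoinedIn.trans`/`JoinedIn.symm` conclude.
The hypothesis `0 < L` of the registered signature is not needed.
-/

noncomputable section

open MeasureTheory Filter Set Metric
open scoped ENNReal NNReal Topology

namespace Summit.AtomisticToContinuum.BoseEinsteinCondensation.Theorems.GroundStateRigidity

open Literature.MathematicalPhysics.QuantumManyBody.BoseGas

namespace CoincidenceFree

variable {N : ℕ}

/-- **Pull-backs of proper subspaces under a pair difference are null.** For `i ≠ j` and a proper
submodule `P ⊊ ℝ³`, the configurations with `zᵢ - zⱼ ∈ P` form a Lebesgue-null set of `(ℝ³)^N`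
(a proper submodule: `Pi.single i w ∉` it for `w ∉ P`; `Measure.addHaar_submodule`). [folklore] -/
theorem volume_setOf_sub_mem_eq_zero {i j : Fin N} (hij : i ≠ j) (P : Submodule ℝ Space)
    (hP : P ≠ ⊤) : volume {Z : Config N | Z i - Z j ∈ P} = 0 := by
  set D : Config N →ₗ[ℝ] Space :=
    LinearMap.proj (R := ℝ) (φ := fun _ : Fin N => Space) i -
      LinearMap.proj (R := ℝ) (φ := fun _ : Fin N => Space) j with hD
  have hDapply : ∀ Z : Config N, D Z = Z i - Z j := fun Z => by
    simp [hD, LinearMap.sub_apply, LinearMap.proj_apply]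
  have hset : {Z : Config N | Z i - Z j ∈ P} = (P.comap D : Set (Config N)) := by
    ext Z
    simp only [mem_setOf_eq, SetLike.mem_coe, Submodule.mem_comap, hDapply]
  rw [hset]
  refine Measure.addHaar_submodule volume _ fun htop => hP ?_
  rw [Submodule.eq_top_iff'] at htop ⊢
  intro w
  have hw := htop (Pi.single i w)
  rw [Submodule.mem_comap, hDapply] at hw
  simpa [Pi.single_eq_same, Pi.single_eq_of_ne' hij] using hw

/-- **The coincidence set is null**: `{Z | ∃ i ≠ j, zᵢ = zⱼ}` is a finite union of proper linear
subspaces `{zᵢ = zⱼ}` of `(ℝ³)^N`. [folklore] -/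
theorem volume_coincidence_eq_zero (N : ℕ) :
    volume {Z : Config N | ∃ i j : Fin N, i ≠ j ∧ Z i = Z j} = 0 := by
  have hsub : {Z : Config N | ∃ i j : Fin N, i ≠ j ∧ Z i = Z j} ⊆
      ⋃ i : Fin N, ⋃ j : Fin N, {Z : Config N | i ≠ j ∧ Z i = Z j} := by
    intro Z hZ
    simpa only [mem_iUnion, mem_setOf_eq] using hZ
  refine measure_mono_null hsub (measure_iUnion_null fun i => measure_iUnion_null fun j => ?_)
  by_cases hij : i = j
  · have h0 : {Z : Config N | i ≠ j ∧ Z i = Z j} = ∅ := by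
      ext Z
      simp [hij]
    rw [h0, measure_empty]
  · refine measure_mono_null (fun Z hZ => ?_)
      (volume_setOf_sub_mem_eq_zero hij (⊥ : Submodule ℝ Space) bot_ne_top)
    simp only [mem_setOf_eq, Submodule.mem_bot, sub_eq_zero]
    exact hZ.2

/-- A line `ℝ ∙ u` is a proper subspace of `ℝ³` (rank `≤ 1 < 3`). [folklore] -/
theorem span_singleton_ne_top (u : Space) : Submodule.span ℝ ({u} : Set Space) ≠ ⊤ := by
  refine (span_lt_top_of_card_lt_finrank ?_).ne
  simp

/-- **No coincidence along a segment towards a generic endpoint.** If `xᵢ ≠ xⱼ` and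
`zᵢ - zⱼ ∉ ℝ ∙ (xᵢ - xⱼ)`, then `(1 - θ) xᵢ + θ zᵢ ≠ (1 - θ) xⱼ + θ zⱼ` for every real `θ`:
a coincidence `(1 - θ)(xᵢ - xⱼ) + θ(zᵢ - zⱼ) = 0` needs `θ ≠ 0` and then solves `zᵢ - zⱼ` into the
line. [folklore] -/
theorem combo_apply_ne {X Z : Config N} {i j : Fin N} (hX : X i ≠ X j)
    (hZ : Z i - Z j ∉ Submodule.span ℝ ({X i - X j} : Set Space)) (θ : ℝ) :
    ((1 - θ) • X + θ • Z) i ≠ ((1 - θ) • X + θ • Z) j := by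
  intro h
  have h' : (1 - θ) • (X i - X j) + θ • (Z i - Z j) = 0 := by
    have h1 : ((1 - θ) • X + θ • Z) i - ((1 - θ) • X + θ • Z) j = 0 := sub_eq_zero.2 h
    simpa only [Pi.add_apply, Pi.smul_apply, smul_sub] using
      (show (1 - θ) • (X i - X j) + θ • (Z i - Z j) =
          ((1 - θ) • X + θ • Z) i - ((1 - θ) • X + θ • Z) j by
        simp only [Pi.add_apply, Pi.smul_apply, smul_sub]; abel).trans h1
  by_cases hθ : θ = 0
  · subst hθ
    have : X i - X j = 0 := by simpa using h'
    exact hX (sub_eq_zero.1 this)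
  · refine hZ (Submodule.mem_span_singleton.2 ⟨θ⁻¹ * (-(1 - θ)), ?_⟩)
    have h2 : θ • (Z i - Z j) = -((1 - θ) • (X i - X j)) := eq_neg_of_add_eq_zero_right h'
    calc (θ⁻¹ * (-(1 - θ))) • (X i - X j) = θ⁻¹ • (-((1 - θ) • (X i - X j))) := by
          rw [mul_smul, neg_smul]
      _ = θ⁻¹ • (θ • (Z i - Z j)) := by rw [h2]
      _ = Z i - Z j := by rw [smul_smul, inv_mul_cancel₀ hθ, one_smul]

/-- **The box is coordinatewise convex**: a convex combination of two configurations of `Λ_L^N`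
lies in `Λ_L^N`. [folklore] -/
theorem combo_mem_boxN {L : ℝ} {X Z : Config N} (hX : X ∈ boxN N L) (hZ : Z ∈ boxN N L) {θ : ℝ}
    (hθ : θ ∈ unitInterval) : (1 - θ) • X + θ • Z ∈ boxN N L := by
  intro i k
  have h := convex_Ioo (0 : ℝ) L (hX i k) (hZ i k) (sub_nonneg.2 hθ.2) hθ.1 (sub_add_cancel 1 θ)
  simpa only [Pi.add_apply, Pi.smul_apply, PiLp.add_apply, PiLp.smul_apply, smul_eq_mul] using h

/-- **Segments towards a generic endpoint stay in the coincidence-free box.** If `X, Z ∈ Λ_L^N`,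
`X` has pairwise distinct points and `zᵢ - zⱼ ∉ ℝ ∙ (xᵢ - xⱼ)` for all `i ≠ j`, then `X` and `Z`
are joined inside `{Z ∈ Λ_L^N | all points distinct}` by the straight segment. [folklore] -/
theorem joinedIn_of_generic {L : ℝ} {X Z : Config N} (hX : X ∈ boxN N L) (hZ : Z ∈ boxN N L)
    (hXc : ∀ i j : Fin N, i ≠ j → X i ≠ X j)
    (hgen : ∀ i j : Fin N, i ≠ j → Z i - Z j ∉ Submodule.span ℝ ({X i - X j} : Set Space)) :
    JoinedIn {Z : Config N | Z ∈ boxN N L ∧ ∀ i j : Fin N, i ≠ j → 0 < dist (Z i) (Z j)} X Z := by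
  refine JoinedIn.ofLine (f := fun θ : ℝ => (1 - θ) • X + θ • Z) (by fun_prop) (by simp) (by simp)
    ?_
  rintro _ ⟨θ, hθ, rfl⟩
  exact ⟨combo_mem_boxN hX hZ hθ,
    fun i j hij => dist_pos.2 (combo_apply_ne (hXc i j hij) (hgen i j hij) θ)⟩

/-- **The coincidence-free box is label-path-connected.** Any two configurations of the open box
with pairwise distinct points are joined inside that set: through an intermediate configuration
`Z` of the box chosen off the null "bad" sets of both endpoints (finite unions of pull-backs of
lines, null by `volume_setOf_sub_mem_eq_zero`; the open box has positive measure), by the two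
straight segments `[X, Z]`, `[Z, Y]` (`joinedIn_of_generic`). [folklore] -/
theorem joinedIn_free {L : ℝ} {X Y : Config N}
    (hX : X ∈ {Z : Config N | Z ∈ boxN N L ∧ ∀ i j : Fin N, i ≠ j → 0 < dist (Z i) (Z j)})
    (hY : Y ∈ {Z : Config N | Z ∈ boxN N L ∧ ∀ i j : Fin N, i ≠ j → 0 < dist (Z i) (Z j)}) :
    JoinedIn {Z : Config N | Z ∈ boxN N L ∧ ∀ i j : Fin N, i ≠ j → 0 < dist (Z i) (Z j)} X Y := by
  -- the bad intermediate configurations: some pair difference on the line of `X`'s or `Y`'s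
  set BAD : Set (Config N) := ⋃ i : Fin N, ⋃ j : Fin N,
    {Z : Config N | i ≠ j ∧ (Z i - Z j ∈ Submodule.span ℝ ({X i - X j} : Set Space) ∨
      Z i - Z j ∈ Submodule.span ℝ ({Y i - Y j} : Set Space))}
  have hBAD : volume BAD = 0 := by
    refine measure_iUnion_null fun i => measure_iUnion_null fun j => ?_
    by_cases hij : i = j
    · have h0 : {Z : Config N | i ≠ j ∧ (Z i - Z j ∈ Submodule.span ℝ ({X i - X j} : Set Space) ∨
          Z i - Z j ∈ Submodule.span ℝ ({Y i - Y j} : Set Space))} = ∅ := by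
        ext Z
        simp [hij]
      rw [h0, measure_empty]
    · refine measure_mono_null (fun Z hZ => hZ.2) (measure_union_null
        (volume_setOf_sub_mem_eq_zero hij _ (span_singleton_ne_top (X i - X j)))
        (volume_setOf_sub_mem_eq_zero hij _ (span_singleton_ne_top (Y i - Y j))))
  -- the box has positive measure, so it is not exhausted by the bad set
  have hpos : volume (boxN N L) ≠ 0 := (isOpen_boxN N L).measure_ne_zero volume ⟨X, hX.1⟩
  have hdiff : volume (boxN N L \ BAD) ≠ 0 := by rwa [measure_sdiff_null hBAD]
  obtain ⟨Z, hZbox, hZbad⟩ := nonempty_of_measure_ne_zero hdiff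
  have hgenX : ∀ i j : Fin N, i ≠ j →
      Z i - Z j ∉ Submodule.span ℝ ({X i - X j} : Set Space) := fun i j hij h =>
    hZbad (mem_iUnion.2 ⟨i, mem_iUnion.2 ⟨j, hij, Or.inl h⟩⟩)
  have hgenY : ∀ i j : Fin N, i ≠ j →
      Z i - Z j ∉ Submodule.span ℝ ({Y i - Y j} : Set Space) := fun i j hij h =>
    hZbad (mem_iUnion.2 ⟨i, mem_iUnion.2 ⟨j, hij, Or.inr h⟩⟩)
  have hXc : ∀ i j : Fin N, i ≠ j → X i ≠ X j := fun i j hij => dist_pos.1 (hX.2 i j hij)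
  have hYc : ∀ i j : Fin N, i ≠ j → Y i ≠ Y j := fun i j hij => dist_pos.1 (hY.2 i j hij)
  exact (joinedIn_of_generic hX.1 hZbox hXc hgenX).trans
    (joinedIn_of_generic hY.1 hZbox hYc hgenY).symm

end CoincidenceFree

/-! ### The stub -/

open CoincidenceFree in
/-- **Stub `stub_coincidenceFree` (CF) of line `zoo_reduction` — the coincidence-free box is conull
and label-path-connected (codimension three).** For every `N` and `L > 0`: the coincidence set
`{∃ i ≠ j, xᵢ = xⱼ}` is Lebesgue-null (a finite union of proper linear subspaces of `(ℝ³)^N`,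
`Measure.addHaar_submodule`), and any two configurations of the open box with all points distinct
are joined by a continuous path of such configurations INSIDE the box: through a generic
intermediate configuration `Z` of the box both straight segments `[X, Z]`, `[Z, Y]` avoid every
coincidence plane (for fixed `X` with distinct points the bad `Z` — some `zᵢ − zⱼ` on the line of
`xᵢ − xⱼ` — form a null, hence non-full, subset of the box; the box is convex). [folklore] -/
theorem stub_coincidenceFree :
    ∀ (N : ℕ) (L : ℝ), 0 < L →
      volume {Z : Config N | ∃ i j : Fin N, i ≠ j ∧ Z i = Z j} = 0 ∧
      ∀ X ∈ {Z : Config N | Z ∈ boxN N L ∧ ∀ i j : Fin N, i ≠ j → 0 < dist (Z i) (Z j)},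
      ∀ Y ∈ {Z : Config N | Z ∈ boxN N L ∧ ∀ i j : Fin N, i ≠ j → 0 < dist (Z i) (Z j)},
        JoinedIn {Z : Config N | Z ∈ boxN N L ∧ ∀ i j : Fin N, i ≠ j → 0 < dist (Z i) (Z j)} X Y := by
  intro N L _
  exact ⟨volume_coincidence_eq_zero N, fun X hX Y hY => joinedIn_free hX hY⟩

end Summit.AtomisticToContinuum.BoseEinsteinCondensation.Theorems.GroundStateRigidity

end
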